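import Summits.AnomalousDissipation.AnomalousDissipation.Theses.TwoAndHalfD
import Summits.AnomalousDissipation.AnomalousDissipation.Theorems.TwoAndHalfDScalarAnomalySteadySourceFormalMeanSquareMixerTransfer

/-!
# Strategist census s2 — typed companion (crux `TwoAndHalfD.ScalarAnomalySteadySourceFormal`, stmt-AnomalousDissipation-0448)

Companion of `STRATEGY-CENSUS.md` (crux-strategist seat `cstrat-stmt-AnomalousDissipation-0448-s2`, 2026-08-17, running
alongside lead c2 of line `budgeted-mixer-template`, reshape r2: ONE open stub S1'' `stub_meanSquareMixerRealizable`).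
NOTHING here is a line or a stub of the crux.  These are the signatures the s2 census refers to, checked to elaborate
against the current tree, with the by-name implications that locate them relative to the crux
`#2 := ScalarAnomalySteadySourceFormal` and to the live kernel S1'' (bookkeeping over LANDED theorems; no `sorry`).
It extends (does not repeat) the s1 companion `STRATEGY_CENSUS.lean` (SourcedAnomalyTwoParam, PeriodicClassicalWitness,
LogStrainFamily, KinematicTemplate/ShadowedTemplate/ShadowGlue, not_crux_of_subLogStrain).

* STRENGTHEN / NEGATION (normal form).  `LimWitness` — the crux with every `limsup`/`liminf` time mean replaced by a
  genuine LIMIT of the running mean (energies `e j ≤ E`, variances `b j ≤ B`, dissipations `d j ≥ ε`), and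
  `limWitness_imp : LimWitness → #2` (a limit is its `limsup`).  The converse `ErgodicNormalForm : #2 → LimWitness`
  (Krylov–Bogoliubov time-average measures of the skew product NS × sourced scalar along the subsequence realising the
  dissipation `limsup`, weak Feller continuity of 2-D NS and of the linear scalar equation on bounded sets, ergodic
  decomposition + Chebyshev selection, Birkhoff) is stated as a `def … : Prop` and argued in the census (§Strengthen);
  it is NOT proved here.  Reading: the `limsup`-vs-`liminf` slack of the crux carries no extra witnesses beyond constants
  (`E ↦ kE`, `B ↦ kB`, `ε ↦ ε/2`, `k = 2 + 8‖h‖²B/ε²`); a disprover may assume stationary ergodic statistics.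
* DECOMPOSITION (rate ladder).  `MeanSquareBody` — the S1''-body verbatim (hypothesis of the landed transfer
  `MeanSquareMixerTransfer.stub_meanSquareMixerTransfer`, p151902) with `meanSquareBody_imp : MeanSquareBody → #2` by
  that name; `MeanSquareBodyAtRate R` — the same clause set with a `j`-DEPENDENT antitone rate `m j` of mass
  `∫₀ᵗ m j ≤ R (ν j)`; `bodyAtRate_of_meanSquareBody : MeanSquareBody → ∃ M, MeanSquareBodyAtRate (fun _ => M)` and
  `bodyAtRate_mono` (the rungs are nested upward).  The crux is the bounded rung; the census records which rungs are
  inhabited by theorems today (only `R ν ≍ 1/ν`, the rest flow / heat releases, cf. the landed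
  `MeanSquareBodyFixedViscosity.stub_meanSquareBodyFixedViscosity`, p154122) and that NO implication runs down the ladder.
-/

noncomputable section

set_option linter.dupNamespace false

namespace Summit.AnomalousDissipation.AnomalousDissipation.Cruxes.ScalarAnomalySteadySourceFormal.StrategistCensusS2

open MeasureTheory Set Filter Topology
open scoped ENNReal NNReal
open Literature.Analysis.FunctionSpaces Literature.Analysis.FluidPDE
open Summit.AnomalousDissipation.AnomalousDissipation.Theses.TwoAndHalfD

/-- Local notation: the flat unit two-torus. -/
local notation "𝕋²" => UnitAddTorus (Fin 2)
/-- Local notation: planar velocity values. -/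
local notation "E²" => EuclideanSpace ℝ (Fin 2)

/-! ## Strengthen / Negation: the limit (ergodic) normal form of the crux -/

/-- **`LimWitness` — the crux in ERGODIC NORMAL FORM (time means converge).**  Verbatim the witness data of
`ScalarAnomalySteadySourceFormal` (one steady smooth solenoidal mean-zero `g`, one smooth mean-zero `h`, `ν_j → 0⁺`,
planar global Leray–Hopf `v_j` forced by `g` from `L²` data, weak sourced scalars `θ_j` from `L²` data), but the three
long-time clauses are asked as LIMITS of the running means `T⁻¹∫₀ᵀ`: the planar energy mean converges to `e j ≤ E`, the
scalar variance mean to `b j ≤ B`, the scalar dissipation mean `T⁻¹∫₀ᵀ ν_j‖∇θ_j‖²` to `d j ≥ ε > 0`.  This is what a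
`μ_j`-generic initial datum of an ERGODIC invariant measure `μ_j` of the skew product (NS_{ν_j}(g) × sourced scalar)
delivers by Birkhoff's theorem; `limWitness_imp` is the trivial direction, `ErgodicNormalForm` the converse. -/
def LimWitness : Prop :=
  ∃ (g : 𝕋² → E²) (h : 𝕋² → ℝ), Torus.IsSmooth g ∧ Torus.IsDivFree g ∧ Torus.HasZeroMean g ∧
    Torus.IsSmooth h ∧ Torus.HasZeroMean h ∧
    ∃ (ν : ℕ → ℝ) (v₀ : ℕ → 𝕋² → E²) (v : ℕ → ℝ → 𝕋² → E²) (θ₀ : ℕ → 𝕋² → ℝ) (θ : ℕ → ℝ → 𝕋² → ℝ)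
      (e b d : ℕ → ℝ) (E B ε : ℝ),
      (∀ j, 0 < ν j) ∧ Tendsto ν atTop (𝓝 0) ∧
      (∀ j, Torus.IsGlobalLerayHopf (ν j) (fun _ => g) (v₀ j) (v j)) ∧
      (∀ j, MemLp (θ₀ j) 2 volume) ∧
      (∀ j, Torus.IsWeakScalarTransportForced (ν j) (v j) (fun _ => h) (θ₀ j) (θ j)) ∧
      (∀ j, Tendsto (timeMean fun t => ∫ x, ‖v j t x‖ ^ 2) atTop (𝓝 (e j))) ∧ (∀ j, e j ≤ E) ∧
      (∀ j, Tendsto (timeMean fun t => Torus.scalarL2Sq (θ j t)) atTop (𝓝 (b j))) ∧ (∀ j, b j ≤ B) ∧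
      (∀ j, Tendsto (timeMean fun t => ν j * (Torus.eScalarGradNormSq (θ j t)).toReal) atTop (𝓝 (d j))) ∧
      0 < ε ∧ (∀ j, ε ≤ d j)

/-- **The trivial direction: a limit is its `limsup`.**  `LimWitness → #2` with the same `(g, h, ν, v₀, v, θ₀, θ)`
and the same constants. -/
theorem limWitness_imp : LimWitness → ScalarAnomalySteadySourceFormal := by
  rintro ⟨g, h, hg, hgd, hgm, hh, hhm, ν, v₀, v, θ₀, θ, e, b, d, E, B, ε, hν, hν0, hLH, hθ₀, hθ, he, heE, hb, hbB,
    hd, hε, hεd⟩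
  refine ⟨g, h, hg, hgd, hgm, hh, hhm, ν, v₀, v, θ₀, θ, hν, hν0, hLH, hθ₀, hθ, ⟨E, fun j => ?_⟩, ⟨B, fun j => ?_⟩,
    ε, hε, fun j => ?_⟩
  · rw [meanEnergy_eq_longTimeAvgSup, longTimeAvgSup, (he j).limsup_eq]
    exact heE j
  · rw [longTimeAvgSup, (hb j).limsup_eq]
    exact hbB j
  · rw [longTimeAvgSup, (hd j).limsup_eq]
    exact hεd j

/-- **`ErgodicNormalForm` — the converse (census §Strengthen/§Negation; Krylov–Bogoliubov + Birkhoff), NOT proved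
here.**  Every witness of the crux yields one in ergodic normal form, with constants `E ↦ kE`, `B ↦ kB`, `ε ↦ ε/2`,
`k = 2 + 8‖h‖²B/ε²`: time-average measures of the pair `(v_j(t), θ_j(t))` along the subsequence `T_n` realising the
dissipation `limsup` are tight on `L²_w × L²_w` (second moments `E`, `B`), their weak-* limits are invariant for the
skew-product semiflow (weak continuity on bounded sets: 2-D NS at `ν_j > 0`, and the linear sourced scalar by
compactness + the landed uniqueness `sourcedScalarUnique2D_proof`), carry `∫‖v‖² ≤ E`, `∫‖θ‖² ≤ B` (lower
semicontinuity) and input power `∫(h,θ) dμ ≥ ε` (weak continuity + uniform integrability of `(h,θ)`; the input–dissipation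
balance makes the power mean `≥` the dissipation mean up to `‖θ₀‖²/2T_n`); stationarity gives `∫ν_j‖∇θ‖² dμ = ∫(h,θ) dμ`;
Chebyshev selects an ERGODIC component with the displayed constants; Birkhoff at a generic datum (a point of the global
attractor, smooth) gives convergent time means.  [cite: FMRT2001 Ch. IV §1–2 (time-average measures are stationary
statistical solutions; 2-D: invariant, carried by the attractor)]. -/
def ErgodicNormalForm : Prop := ScalarAnomalySteadySourceFormal → LimWitness

/-! ## Decomposition: the rate ladder of the statistical kernel S1'' -/

/-- **`MeanSquareBody` — the S1''-body, verbatim** (the hypothesis of the landed transfer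
`MeanSquareMixerTransfer.stub_meanSquareMixerTransfer`, p151902; the statement of the live stub
`stub_meanSquareMixerRealizable` of `Lines/budgeted_mixer_template.lean`). -/
def MeanSquareBody : Prop :=
  ∃ (g : UnitAddTorus (Fin 2) → EuclideanSpace ℝ (Fin 2)) (h : UnitAddTorus (Fin 2) → ℝ),
      Torus.IsSmooth g ∧ Torus.IsDivFree g ∧ Torus.HasZeroMean g ∧ Torus.IsSmooth h ∧ Torus.HasZeroMean h ∧
      ∃ (ν : ℕ → ℝ) (v : ℕ → ℝ → UnitAddTorus (Fin 2) → EuclideanSpace ℝ (Fin 2))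
        (p : ℕ → ℝ → UnitAddTorus (Fin 2) → ℝ) (φ : ℕ → ℝ → ℝ → UnitAddTorus (Fin 2) → ℝ)
        (m : ℝ → ℝ) (E s₀ B M ε : ℝ),
        (∀ j, 0 < ν j) ∧ Tendsto ν atTop (𝓝 0) ∧
        (∀ j, Torus.IsClassicalNSSolutionOn (Set.Ici 0) (ν j) (fun _ => g) (v j) (p j)) ∧
        (∀ j t, 0 ≤ t → ∫ x, ‖v j t x‖ ^ 2 ≤ E) ∧
        (∀ j s, 0 ≤ s → Torus.IsClassicalScalarTransportOn (Set.Ici s) (ν j) (v j) (φ j s) ∧ φ j s s = h) ∧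
        0 ≤ s₀ ∧ 0 ≤ B ∧ Antitone m ∧ (∀ τ, 0 < m τ) ∧ (∀ t, 0 ≤ t → ∫ τ in (0 : ℝ)..t, m τ ≤ M) ∧
        (∀ j τ T, 0 ≤ τ → s₀ ≤ T →
          ∫ s in s₀..T, Torus.scalarL2Sq (φ j s (s + τ)) ≤ (B + (T - s₀)) * m τ ^ 2 * Torus.scalarL2Sq h) ∧
        0 < ε ∧
        (∀ j, ε ≤ liminf (timeMean fun t => ∫ s in (0 : ℝ)..t, ∫ x, h x * φ j s t x) atTop)

/-- The S1''-body closes the crux — BY NAME, through the landed transfer (p151902). -/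
theorem meanSquareBody_imp : MeanSquareBody → ScalarAnomalySteadySourceFormal :=
  Summit.AnomalousDissipation.AnomalousDissipation.Theorems.ScalarAnomalySteadySourceFormal.MeanSquareMixerTransfer.stub_meanSquareMixerTransfer

/-- **`MeanSquareBodyAtRate R` — the rung of rate `R` of the S1'' ladder.**  The S1'' clause set with a `j`-DEPENDENT
antitone positive rate function `m j` whose mass is bounded by the RATE FUNCTION of the viscosity, `∫₀ᵗ m j ≤ R (ν j)`
for all `t ≥ 0`: mean-square decay of the releases of `h` over release times at rate `m j`, plus the liminf-mean
Green–Kubo floor.  `R ν ≍ 1/ν` is the heat-kernel rung (inhabited by the rest flow: releases `e^{-4π²ντ}h` of a gravest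
eigenfunction, cf. the landed fixed-viscosity certificate p154122); `R ≍ log(1/ν)` is the Batchelor rung the cascade
phenomenology predicts for any `O(1)`-strain chaotic regime; `R = O(1)` is S1'' (`bodyAtRate_of_meanSquareBody`). -/
def MeanSquareBodyAtRate (R : ℝ → ℝ) : Prop :=
  ∃ (g : 𝕋² → E²) (h : 𝕋² → ℝ),
      Torus.IsSmooth g ∧ Torus.IsDivFree g ∧ Torus.HasZeroMean g ∧ Torus.IsSmooth h ∧ Torus.HasZeroMean h ∧
      ∃ (ν : ℕ → ℝ) (v : ℕ → ℝ → 𝕋² → E²) (p : ℕ → ℝ → 𝕋² → ℝ) (φ : ℕ → ℝ → ℝ → 𝕋² → ℝ)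
        (m : ℕ → ℝ → ℝ) (E s₀ B ε : ℝ),
        (∀ j, 0 < ν j) ∧ Tendsto ν atTop (𝓝 0) ∧
        (∀ j, Torus.IsClassicalNSSolutionOn (Set.Ici 0) (ν j) (fun _ => g) (v j) (p j)) ∧
        (∀ j t, 0 ≤ t → ∫ x, ‖v j t x‖ ^ 2 ≤ E) ∧
        (∀ j s, 0 ≤ s → Torus.IsClassicalScalarTransportOn (Set.Ici s) (ν j) (v j) (φ j s) ∧ φ j s s = h) ∧
        0 ≤ s₀ ∧ 0 ≤ B ∧ (∀ j, Antitone (m j)) ∧ (∀ j τ, 0 < m j τ) ∧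
        (∀ j t, 0 ≤ t → ∫ τ in (0 : ℝ)..t, m j τ ≤ R (ν j)) ∧
        (∀ j τ T, 0 ≤ τ → s₀ ≤ T →
          ∫ s in s₀..T, Torus.scalarL2Sq (φ j s (s + τ)) ≤ (B + (T - s₀)) * m j τ ^ 2 * Torus.scalarL2Sq h) ∧
        0 < ε ∧
        (∀ j, ε ≤ liminf (timeMean fun t => ∫ s in (0 : ℝ)..t, ∫ x, h x * φ j s t x) atTop)

/-- **S1'' is the bounded rung.**  `MeanSquareBody → ∃ M, MeanSquareBodyAtRate (fun _ => M)` (take `m j := m`). -/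
theorem bodyAtRate_of_meanSquareBody : MeanSquareBody → ∃ M : ℝ, MeanSquareBodyAtRate (fun _ => M) := by
  rintro ⟨g, h, hg, hgd, hgm, hh, hhm, ν, v, p, φ, m, E, s₀, B, M, ε, hν, hν0, hNS, hE, hrel, hs₀, hB, hm, hm0, hmM,
    hMS, hε, hGK⟩
  exact ⟨M, g, h, hg, hgd, hgm, hh, hhm, ν, v, p, φ, fun _ => m, E, s₀, B, ε, hν, hν0, hNS, hE, hrel, hs₀, hB,
    fun _ => hm, fun _ => hm0, fun _ t ht => hmM t ht, fun j τ T hτ hT => hMS j τ T hτ hT, hε, hGK⟩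

/-- **The rungs are nested upward**: a slower rate function is easier.  (`R ≤ R'` on the viscosities that occur
suffices; stated for all positive `ν`.) -/
theorem bodyAtRate_mono {R R' : ℝ → ℝ} (hRR' : ∀ ν, 0 < ν → R ν ≤ R' ν) :
    MeanSquareBodyAtRate R → MeanSquareBodyAtRate R' := by
  rintro ⟨g, h, hg, hgd, hgm, hh, hhm, ν, v, p, φ, m, E, s₀, B, ε, hν, hν0, hNS, hE, hrel, hs₀, hB, hm, hm0, hmR,
    hMS, hε, hGK⟩
  exact ⟨g, h, hg, hgd, hgm, hh, hhm, ν, v, p, φ, m, E, s₀, B, ε, hν, hν0, hNS, hE, hrel, hs₀, hB, hm, hm0,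
    fun j t ht => (hmR j t ht).trans (hRR' (ν j) (hν j)), hMS, hε, hGK⟩

end Summit.AnomalousDissipation.AnomalousDissipation.Cruxes.ScalarAnomalySteadySourceFormal.StrategistCensusS2

end
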